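import Literature.NumberTheory.Automorphic.NewformAdelisationHeckeOperator
import Literature.NumberTheory.Automorphic.WeightOneDescent
import Literature.NumberTheory.Automorphic.AutomorphicRepOfForm
import Literature.NumberTheory.Automorphic.AutomorphicTwistWeightOne
import Literature.NumberTheory.Automorphic.AlgebraicityTwist
import Literature.NumberTheory.Automorphic.LanglandsTunnellLSeriesProofs
import Literature.NumberTheory.Automorphic.Sweep1SymmetricPowerAdelic
import Literature.NumberTheory.EllipticCurves.NewformGaloisRep
import HarnessLib

/-! # Stub stub_dictionaryL of line adelic-newform-datum-double-twist (crux stmt-Langlands-12944 `PhantomRMYoshida.SerreKWAutomorphicGL2`)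

The L-normalised dictionary for a newform `f ∈ S_k(Γ₁(N))`, `k ≥ 2`: if a cuspidal Borel–Jacquet
datum `π = W / W'` on `GL₂(𝔸_ℚ)` contains the adelic lift `φ_f` in `W ∖ W'` and has archimedean
parameter `{(k-1)/2, (1-k)/2}`, then the double twist `π₂ = π ⊗ (ε⁻¹ ∘ det) ⊗ |det|^{(k-1)/2}`
(`ε` the nebentypus of `f`) is an L-algebraic cuspidal datum whose Satake multiset at almost every
finite place `v = q` is `{β₁⁻¹, β₂⁻¹}`, `β₁, β₂` the complex roots of the Hecke polynomial
`X² - a_q X + ε(q) q^{k-1}`.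

* Part I (`hasSatakeParamAt_pair_of_adelicLiftFunA_mem`): at `v ∤ N`, `π` has the unitary Satake
  pair `{x, y}`, `x + y = a_q (√q)^{1-k}`, `xy = ε(q)`, witnessed by the `K(N)`-fixed vector `φ_f`
  and the operator identities `T_{v,1} φ_f = (√q)^{2-k} φ_{T_q f}`, `T_{v,2} φ_f = φ_{⟨q⟩ f}`
  (Gelbart 1975, Lemma 3.7; Bump 1997, §3.6).
* Part II: the finite-order twist by `ofDirichlet ε⁻¹` multiplies the pair by `ε(q)⁻¹`
  (Arthur–Clozel 1989, Ch. 3, proof of Thm. 3.1), preserving the archimedean parameter; the norm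
  twist `|det|^{(k-1)/2}` multiplies by `q^{-(k-1)/2}` and shifts the infinity type to
  `{(k-1, 0), (0, k-1)}`, L-algebraic (Buzzard–Gee 2014, §3.1, §5.3).
-/

noncomputable section

open scoped MatrixGroups Classical Polynomial
open NumberField IsDedekindDomain Filter Polynomial CongruenceSubgroup
open Literature.NumberTheory.Automorphic Literature.NumberTheory.EllipticCurves.ModularForms
  Literature.NumberTheory.GaloisRepresentations

namespace Summit.Langlands.Langlands.Cruxes.SerreKWAutomorphicGL2.AdelicNewformDatumDoubleTwist

set_option linter.dupNamespace false

open Rat.HeightOneSpectrum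

/-! ## Part I — the unitary Satake pair of a datum containing `φ_f` -/

section PartI

variable {N : ℕ} [NeZero N] {k : ℤ} {hcpt : isCompact_glFiniteIntegralLevel 2 ℚ}

omit [NeZero N] in
/-- `φ_{c f} = c φ_f` on the trunk's function space (`adelicLiftFun_smul`). [folklore] -/
private theorem adelicLiftFunA_smul (c : ℂ) (g : UpperHalfPlane → ℂ) :
    adelicLiftFunA N k (c • g) = c • adelicLiftFunA N k g :=
  adelicLiftFun_smul N k c g

/-- **Part I: the unitary Satake pair of a datum containing `φ_f`.** Let `π = W / W'` be a
Borel–Jacquet datum on `GL₂(𝔸_ℚ)` with `φ_f ∈ W ∖ W'` for a cusp form `f ∈ S_k(Γ₁(N))`, and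
`v = q ∤ N` a finite place with `T_q f = a f`, `⟨q⟩ f = e f`. If `x + y = a (√q)^{1-k}` and
`xy = e` then `π` has Satake parameter `{x, y}` at `v`: the `K(N)`-fixed vector `φ_f` satisfies
`T_{v,0} φ_f = φ_f`, `T_{v,1} φ_f = (√q)^{2-k} φ_{T_q f} = √q (x + y) φ_f`,
`T_{v,2} φ_f = φ_{⟨q⟩ f} = xy φ_f` (Gelbart 1975, Lemma 3.7; Bump 1997, Thm. 3.6.1, pp. 340–342).
[cite: Gelbart1975, §3 Lemma 3.7] [cite: Bump1997, Thm. 3.6.1, pp. 340–342] -/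
theorem hasSatakeParamAt_pair_of_adelicLiftFunA_mem
    (π : AutomorphicRepData (AutomorphyDatum.gl 2 ℚ hcpt)) (f : CuspForm (Gamma1 N) k)
    (hφ : adelicLiftFunA N k ⇑f ∈ π.W) (hφ' : adelicLiftFunA N k ⇑f ∉ π.W')
    {v : HeightOneSpectrum (𝓞 ℚ)} [NeZero (natGenerator v)] (hv : ¬ v.asIdeal ∣ Ideal.span {(N : 𝓞 ℚ)})
    {a e x y : ℂ} (hT : heckeT (Gamma1 N) k (natGenerator v) f = a • f)
    (hD : diamondOp N k ((natGenerator v : ℕ) : ZMod N) f = e • f)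
    (hxy : x + y = a * ((((Real.sqrt (natGenerator v) : ℝ) : ℂ)) ^ (k - 1))⁻¹) (hxy' : x * y = e) :
    π.HasSatakeParamAt v ({x, y} : Multiset ℂ) := by
  have h𝔫 : (Ideal.span {(N : 𝓞 ℚ)} : Ideal (𝓞 ℚ)) ≠ 0 := Rat.span_natCast_ne_zero N
  have hfixmem := adelicLiftFunA_mem_fixedPoints_principalCongruenceLevel (k := k) f
  have hfix : ∀ u ∈ principalCongruenceLevel 2 ℚ (Ideal.span {(N : 𝓞 ℚ)}),
      rightTranslation (AdelicGroupData.gl 2 ℚ) u (adelicLiftFunA N k f) = adelicLiftFunA N k f :=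
    fun u hu =>
      ((rightTranslation (AdelicGroupData.gl 2 ℚ)).mem_fixedPoints _
        (adelicLiftFunA N k f)).1 hfixmem u hu
  have hs0 : ((Real.sqrt (natGenerator v) : ℝ) : ℂ) ≠ 0 := by
    exact_mod_cast (Real.sqrt_pos.2 (Nat.cast_pos.2 (prime_natGenerator v).pos)).ne'
  refine π.hasSatakeParamAt_of_eigenvector h𝔫 hv (Rat.valued_localUniformizer v) (by simp) hφ hφ'
    hfix fun i hi => ?_
  rw [Literature.NumberTheory.GaloisRepresentations.Rat.residueCard_eq_natGenerator]
  interval_cases i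
  · -- `T_{v,0} = 1`
    have h0 : Multiset.esymm ({x, y} : Multiset ℂ) 0 = 1 := by
      simp [Multiset.esymm, Multiset.powersetCard_zero_left]
    rw [heckeDiagAt_zero, h0, Nat.zero_mul, pow_zero, one_mul, one_smul]
    exact heckeOperator_one_apply _ _ hfixmem
  · -- `T_{v,1} φ_f = (√q)^{2-k} a φ_f`
    rw [heckeOperator_principalCongruenceLevel_adelicLiftFunA_one f hv, hT,
      CuspForm.IsGLPos.coe_smul, adelicLiftFunA_smul, smul_smul]
    congr 1
    simp only [Multiset.insert_eq_cons, Multiset.esymm_pair_one, hxy]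
    rw [show k - 1 = (k - 2) + 1 by ring, zpow_add_one₀ hs0]
    field_simp
    ring
  · -- `T_{v,2} φ_f = e φ_f`
    rw [heckeOperator_principalCongruenceLevel_adelicLiftFunA_two f hv, hD,
      CuspForm.IsGLPos.coe_smul, adelicLiftFunA_smul]
    congr 1
    simp [Multiset.insert_eq_cons, Multiset.esymm_pair_two, hxy']

end PartI

/-! ## Part II — bookkeeping lemmas for the double twist -/

/-- **The infinity type of the weight-`k` discrete series in the unitary normalisation and its
half-twist.** There is a well-formed infinity type `T` on `GL₂/ℚ` with `a`-exponents
`{(k-1)/2, (1-k)/2}` (weights `((k-1)/2, (1-k)/2)`, `((1-k)/2, (k-1)/2)`, swap-stable) whose twist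
by `|det|^{(k-1)/2}` has integer exponents `{(k-1, 0), (0, k-1)}`, i.e. is L-algebraic
(Buzzard–Gee 2014, §3.1 and §5.3). [cite: BuzzardGeeLMS2014, Def. 3.1.1 and §3.4] -/
theorem exists_infinityType_halfTwist_isLAlgebraic (k : ℤ) :
    ∃ T : InfinityType ℚ 2, T.IsWellFormed ∧
      (fun σ => (T σ).map ArchWeight.a) =
        (fun _ => ({((k : ℂ) - 1) / 2, (1 - (k : ℂ)) / 2} : Multiset ℂ)) ∧
      (T.twist ((((k : ℝ) - 1) / 2 : ℝ) : ℂ)).IsLAlgebraic := by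
  let w₁ : ArchWeight := ⟨((k : ℂ) - 1) / 2, (1 - (k : ℂ)) / 2, k - 1, by push_cast; ring⟩
  let w₂ : ArchWeight := ⟨(1 - (k : ℂ)) / 2, ((k : ℂ) - 1) / 2, 1 - k, by push_cast; ring⟩
  have hsw₁ : w₁.swap = w₂ := rfl
  have hsw₂ : w₂.swap = w₁ := rfl
  have hc : ((((k : ℝ) - 1) / 2 : ℝ) : ℂ) = ((k : ℂ) - 1) / 2 := by push_cast; ring
  refine ⟨fun _ => {w₁, w₂}, ⟨fun _ => rfl, fun σ => ?_⟩, ?_, ?_⟩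
  · simp only [Multiset.insert_eq_cons, Multiset.map_cons, Multiset.map_singleton, hsw₁, hsw₂]
    exact Multiset.cons_swap w₁ w₂ 0
  · funext σ
    simp only [Multiset.insert_eq_cons, Multiset.map_cons, Multiset.map_singleton]
    rfl
  · intro σ p hp
    simp only [InfinityType.twist_apply, Multiset.insert_eq_cons, Multiset.map_cons,
      Multiset.map_singleton, Multiset.mem_cons, Multiset.mem_singleton] at hp
    rcases hp with rfl | rfl
    · refine ⟨k - 1, 0, ?_, ?_⟩
      · rw [ArchWeight.twist_a, hc]; push_cast; ring
      · rw [ArchWeight.twist_b, hc]; push_cast; ring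
    · refine ⟨0, k - 1, ?_, ?_⟩
      · rw [ArchWeight.twist_a, hc]; push_cast; ring
      · rw [ArchWeight.twist_b, hc]; push_cast; ring

/-- `q^{-m/2} = ((√q)^m)⁻¹` as complex numbers, for natural `q, m`. [folklore] -/
private theorem natCast_cpow_neg_half (q m : ℕ) :
    (q : ℂ) ^ (-(((m : ℝ) / 2 : ℝ) : ℂ)) = ((((Real.sqrt q : ℝ) : ℂ)) ^ m)⁻¹ := by
  have hq : (0 : ℝ) ≤ q := Nat.cast_nonneg q
  rw [Complex.cpow_neg, ← Complex.ofReal_natCast, ← Complex.ofReal_cpow hq,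
    show ((m : ℝ) / 2 : ℝ) = (1 / 2) * m by ring, Real.rpow_mul hq, ← Real.sqrt_eq_rpow,
    Real.rpow_natCast, Complex.ofReal_pow]

/-- The Hecke polynomial `X² - a X + e q^{m}` factors as `(X - B x)(X - B y)` with `B = (√q)^m`
when `x + y = a B⁻¹`, `xy = e` (Vieta). [folklore] -/
private theorem heckePolynomial_eq_prod_of_pair {q m : ℕ} {a e x y : ℂ}
    (hB : (((Real.sqrt q : ℝ) : ℂ)) ≠ 0)
    (hxy : x + y = a * ((((Real.sqrt q : ℝ) : ℂ)) ^ m)⁻¹) (hxy' : x * y = e) :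
    (X ^ 2 - C a * X + C (e * (q : ℂ) ^ m) : ℂ[X]) =
      (({(((Real.sqrt q : ℝ) : ℂ)) ^ m * x, (((Real.sqrt q : ℝ) : ℂ)) ^ m * y} : Multiset ℂ).map
        fun t => X - C t).prod := by
  set B : ℂ := (((Real.sqrt q : ℝ) : ℂ)) ^ m with hBdef
  have hBm : B ≠ 0 := pow_ne_zero _ hB
  have hsq : (((Real.sqrt q : ℝ) : ℂ)) ^ 2 = (q : ℂ) := by
    rw [← Complex.ofReal_pow, Real.sq_sqrt (Nat.cast_nonneg q), Complex.ofReal_natCast]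
  have hB2 : B * B = (q : ℂ) ^ m := by
    rw [hBdef, ← pow_add, ← two_mul, pow_mul, hsq]
  have h1 : B * x + B * y = a := by
    rw [← mul_add, hxy, mul_left_comm, mul_inv_cancel₀ hBm, mul_one]
  have h2 : B * x * (B * y) = e * (q : ℂ) ^ m := by
    rw [← hB2, ← hxy']; ring
  simp only [Multiset.insert_eq_cons, Multiset.map_cons, Multiset.map_singleton,
    Multiset.prod_cons, Multiset.prod_singleton]
  rw [← h1, ← h2]
  simp only [map_add, map_mul]
  ring

/-- The inverted roots: `{B⁻¹ e⁻¹ x, B⁻¹ e⁻¹ y} = {(B x)⁻¹, (B y)⁻¹}` when `xy = e ≠ 0`.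
[folklore] -/
private theorem map_inv_pair_eq {B e x y : ℂ} (hB : B ≠ 0) (hx : x ≠ 0) (hy : y ≠ 0)
    (hxy' : x * y = e) :
    Multiset.map ((fun t => B⁻¹ * t) ∘ (fun t => e⁻¹ * t)) ({x, y} : Multiset ℂ) =
      Multiset.map (·⁻¹) ({B * x, B * y} : Multiset ℂ) := by
  have e1 : B⁻¹ * (e⁻¹ * x) = (B * y)⁻¹ := by rw [← hxy']; field_simp
  have e2 : B⁻¹ * (e⁻¹ * y) = (B * x)⁻¹ := by rw [← hxy']; field_simp
  simp only [Function.comp_def, Multiset.insert_eq_cons, Multiset.map_cons, Multiset.map_singleton,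
    e1, e2]
  exact Multiset.pair_comm _ _

/-! ## The stub -/

/-- **Stub 7 (the L-normalised dictionary: unitary Satake pairs of a datum containing `φ_f`, then the
double twist `⊗ (ofDirichlet ε)⁻¹∘det ⊗ |det|^{(k-1)/2}`).**  Let `f ∈ S_k(Γ₁(N))`, `k ≥ 2`, be a
NEWFORM and `π = W / W'` a cuspidal datum on `GL₂(𝔸_ℚ)` with `φ_f ∈ W ∖ W'` and archimedean parameter
`{(k-1)/2, (1-k)/2}`.  Then there is an L-ALGEBRAIC cuspidal datum `π₂` whose Satake parameter at
almost every finite place `v = q` is `{β₁⁻¹, β₂⁻¹}`, `β_{1,2}` the complex roots of the Hecke polynomial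
`H_q(f) = X² - a_q X + ε(q) q^{k-1}` (`ModularForms.heckePolynomial f q` mapped to `ℂ`).
Proof: (i) at `v ∤ N`, `π` has the unitary Satake pair `{x, y}`, `x + y = a_q (√q)^{1-k}`,
`xy = ε(q)` (`hasSatakeParamAt_pair_of_adelicLiftFunA_mem` with `T_q f = a_q f`, `⟨q⟩ f = ε(q) f`);
(ii) `π₁ := π ⊗ (ofDirichlet ε⁻¹ ∘ det)` has pair `ε(q)⁻¹{x, y} = {y⁻¹, x⁻¹}` a.e.
(`eventually_hasSatakeParamAt_twist`, `valueAtUniformizer_ofDirichlet`) and the same archimedean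
parameter (`HasArchParameter.twist`); (iii) `π₂ := π₁ ⊗ |det|^{(k-1)/2}`
(`exists_twist_hasInfinityType`) has Satake `q^{-(k-1)/2}{y⁻¹, x⁻¹} = {β_j⁻¹}`
(`HasSatakeParamAt.of_map_mulChar_detTwist_of_cpow`, `β = (√q)^{k-1}{x, y}` by Vieta) and infinity
type `{(k-1, 0), (0, k-1)}`, L-algebraic.
[cite: Gelbart1975, §3 Lemma 3.7 and Thm. 5.19] [cite: Bump1997, Thm. 3.6.1, pp. 340–342]
[cite: BuzzardGeeLMS2014, Def. 3.1.1 and §3.4] [cite: ArthurClozelAMS120, Ch. 3, proof of Thm. 3.1 (p. 172)] -/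
theorem stub_dictionaryL :
    ∀ (N : ℕ) [NeZero N] (k : ℤ), 2 ≤ k → ∀ (f : CuspForm (Gamma1 N) k), IsNewform1 f →
      ∀ (hcpt : isCompact_glFiniteIntegralLevel 2 ℚ) (π : CuspidalAutomorphicRepData 2 ℚ hcpt),
        adelicLiftFunA N k ⇑f ∈ π.1.W → adelicLiftFunA N k ⇑f ∉ π.1.W' →
        π.1.HasArchParameter (fun _ => ({((k : ℂ) - 1) / 2, (1 - (k : ℂ)) / 2} : Multiset ℂ)) →
          ∃ π₂ : CuspidalAutomorphicRepData 2 ℚ hcpt, π₂.1.IsLAlgebraic ∧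
            ∀ᶠ v : HeightOneSpectrum (𝓞 ℚ) in Filter.cofinite,
              π₂.1.HasSatakeParamAt v
                (((heckePolynomial f ((Rat.HeightOneSpectrum.primesEquiv v : Nat.Primes) : ℕ)).map
                    (algebraMap (coeffCharField f) ℂ)).roots.map (·⁻¹)) := by
  intro N _ k hk f hf hcpt π hW hW' harch
  obtain ⟨m, hm⟩ : ∃ m : ℕ, k - 1 = m := ⟨(k - 1).toNat, (Int.toNat_of_nonneg (by omega)).symm⟩
  -- (ii) the finite-order twist by `ε⁻¹ ∘ det`
  set ε : DirichletCharacter ℂ N := nebentypus f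
  set χ₁ : HeckeCharacter ℚ := HeckeCharacter.ofDirichlet ε⁻¹ with hχ₁def
  have hχ₁ : χ₁.IsFiniteOrder := HeckeCharacter.isFiniteOrder_ofDirichlet ε⁻¹
  set π₁ : CuspidalAutomorphicRepData 2 ℚ hcpt := π.twist χ₁ hχ₁
  have harch₁ :
      π₁.1.HasArchParameter (fun _ => ({((k : ℂ) - 1) / 2, (1 - (k : ℂ)) / 2} : Multiset ℂ)) :=
    AutomorphicRepData.HasArchParameter.twist π.1 χ₁ hχ₁ harch
  -- (iii) the norm twist `|det|^{(k-1)/2}` and the infinity type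
  obtain ⟨T, hTwf, hTa, hTL⟩ := exists_infinityType_halfTwist_isLAlgebraic k
  have hT₁ : π₁.1.HasInfinityType T := ⟨hTwf, hTa ▸ harch₁⟩
  obtain ⟨χ, π₂, hχ, hW₂, hW₂', hT₂⟩ :=
    CuspidalAutomorphicRepData.exists_twist_hasInfinityType π₁ (((k : ℝ) - 1) / 2) hT₁
  refine ⟨π₂, ⟨_, hT₂, hTL⟩, ?_⟩
  -- (iv)–(vi) the Satake parameters at almost every `v`
  have h1 := AutomorphicRepData.eventually_hasSatakeParamAt_twist π.1 hχ₁
  have h2 : ∀ᶠ v : HeightOneSpectrum (𝓞 ℚ) in cofinite,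
      ¬ v.asIdeal ∣ Ideal.span {(N : 𝓞 ℚ)} := by
    rw [eventually_cofinite]
    simpa only [not_not] using Ideal.finite_factors (Rat.span_natCast_ne_zero N)
  filter_upwards [h1, h2] with v hv₁ hv
  -- notation at `v`: `q`, `a = a_q`, `e = ε(q)`, `r = √q`
  have hq : ((Rat.HeightOneSpectrum.primesEquiv v : Nat.Primes) : ℕ) = natGenerator v := rfl
  rw [hq]
  have hqp : (natGenerator v).Prime := prime_natGenerator v
  haveI : NeZero (natGenerator v) := ⟨hqp.ne_zero⟩
  have hqN : ¬ natGenerator v ∣ N := fun h => hv ((Rat.natGenerator_dvd_iff v N).1 h)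
  have hs0 : ((Real.sqrt (natGenerator v) : ℝ) : ℂ) ≠ 0 := by
    exact_mod_cast (Real.sqrt_pos.2 (Nat.cast_pos.2 hqp.pos)).ne'
  -- (i) the eigenvalues of the newform and the unitary pair
  have hT : heckeT (Gamma1 N) k (natGenerator v) f =
      (UpperHalfPlane.qExpansion 1 ⇑f).coeff (natGenerator v) • f := by
    rw [← IsNewform1.heckeEigenvalue_eq_coeff_holds hf hqp]
    exact heckeT_eq_heckeEigenvalue_smul f (natGenerator v) (hf.2.1 _ hqp)
  have hD : diamondOp N k ((natGenerator v : ℕ) : ZMod N) f = ε (natGenerator v : ZMod N) • f :=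
    hf.diamondOp_natCast_apply_of_not_dvd hqp hqN
  have he : ε (natGenerator v : ZMod N) ≠ 0 :=
    ((ZMod.isUnit_prime_of_not_dvd hqp hqN).map ε).ne_zero
  obtain ⟨x, y, hxy, hxy'⟩ := exists_pair_add_eq_mul_eq
    ((UpperHalfPlane.qExpansion 1 ⇑f).coeff (natGenerator v) *
      ((((Real.sqrt (natGenerator v) : ℝ) : ℂ)) ^ m)⁻¹) (ε (natGenerator v : ZMod N))
  have hx : x ≠ 0 := fun h => he (by rw [← hxy', h, zero_mul])
  have hy : y ≠ 0 := fun h => he (by rw [← hxy', h, mul_zero])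
  have hsat : π.1.HasSatakeParamAt v ({x, y} : Multiset ℂ) :=
    hasSatakeParamAt_pair_of_adelicLiftFunA_mem π.1 f hW hW' hv hT hD
      (by rw [hm, zpow_natCast]; exact hxy) hxy'
  -- (ii) + (iv): the Satake parameters of the two twists
  have hsat₂ :=
    AutomorphicRepData.HasSatakeParamAt.of_map_mulChar_detTwist_of_cpow hχ hW₂ hW₂' (hv₁ _ hsat)
  -- (v) the multiset identity
  have hc₁ : χ₁.valueAtUniformizer v = (ε (natGenerator v : ZMod N))⁻¹ := by
    rw [hχ₁def, HeckeCharacter.valueAtUniformizer_ofDirichlet ε⁻¹ hqN,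
      Literature.NumberTheory.GaloisRepresentations.Rat.residueCard_eq_natGenerator,
      MulChar.inv_apply_eq_inv']
  have hc₂ : (v.residueCard : ℂ) ^ (-(((((k : ℝ) - 1) / 2 : ℝ)) : ℂ)) =
      ((((Real.sqrt (natGenerator v) : ℝ) : ℂ)) ^ m)⁻¹ := by
    have hkm : ((k : ℝ) - 1) = (m : ℝ) := by exact_mod_cast hm
    rw [Literature.NumberTheory.GaloisRepresentations.Rat.residueCard_eq_natGenerator, hkm]
    exact natCast_cpow_neg_half _ _
  rw [hc₁, hc₂, Multiset.map_map, map_inv_pair_eq (pow_ne_zero _ hs0) hx hy hxy'] at hsat₂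
  rw [map_heckePolynomial, hm, zpow_natCast, heckePolynomial_eq_prod_of_pair hs0 hxy hxy',
    Polynomial.roots_multiset_prod_X_sub_C]
  exact hsat₂

end Summit.Langlands.Langlands.Cruxes.SerreKWAutomorphicGL2.AdelicNewformDatumDoubleTwist

end
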